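import Summits.CriticalPhenomena.CardyFormulaZ2.Theorems.CardyMagicRigidityNestingRigidityLoopCrossCount
import Summits.CriticalPhenomena.CardyFormulaZ2.Theorems.CardyMagicRigidityNestingRigidityBigLoopsFirstMoment
import HarnessLib

/-!
# Crux `NestingRigidity`, line `positive-cone-weight-doubling`: joint disjoint occurrence over
# many annuli (the global BK step of keystone K6), and its deterministic core on bond-`ℤ²`

Crux `Summit.CriticalPhenomena.CardyFormulaZ2.Theses.CardyMagicRigidity.NestingRigidity`
(stmt-CriticalPhenomena-4835), line `positive-cone-weight-doubling`, keystone stub K6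
`expMoment_ncard_bigLoops_le` (ALL-ORDER exponential moments of the number of big loops in a
window, uniformly in the mesh).  The first-moment files (K1 `…BigLoopsFirstMoment`, K2
`…LoopCrossCount*`) bound the loops near ONE small ball by iterated BK in ONE annulus; K6 needs
the joint law over a whole covering by small balls, i.e. ONE disjoint-occurrence product over all
the annuli of the covering.  This file supplies, with no cited fact and no definition:

* §1 **joint disjoint occurrence of a finite family of powers** — the event
  `(A₀)^{□k₀} □ ((A₁)^{□k₁} □ (⋯ □ univ))`, written `List.foldr disjointOccurrence univ` (`□`-fold) over
  `List.ofFn fun i ↦ (A i)^{□ k i}`: it is increasing and determined by any common determining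
  set (`BigLoopsExp.isUpperSet_foldr`, `BigLoopsExp.determinedBy_foldr`), it is witnessed by a
  family of pairwise disjoint open witnesses, `k i` of them in `A i`
  (`BigLoopsExp.mem_foldr_ofFn_of_pairwise_disjoint`), and under any BK inequality for increasing
  events determined by the common set its probability is `≤ ∏ i P(A i)^{k i}`
  (`BigLoopsExp.measureReal_foldr_ofFn_le_prod`; bond-`ℤ²`: Reimer `reimer_holds`, site-`𝕋`:
  `sitePercolation_bk`);
* §2 **the deterministic core on bond-`ℤ²`** (`BigLoopsExp.mem_foldr_of_typeOne_families`):
  pairwise disjoint finite families `T i` of counter-clockwise (type-`1`) loops of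
  `bondLoopConfig δ 0 ω`, the loops of `T i` meeting `B̄(c i, a i)` and `ℂ ∖ B(c i, b i)`
  (`a i + 2δ ≤ b i`), put `ω` in the joint disjoint occurrence of
  `(annulusOpenCrossing (c i) δ (a i + δ) (b i - δ))^{□ k i}` for all `k i ≤ #T i` — distinct type-`1`
  loops have distinct rim clusters (`LoopCrossCount.unbasedLoop_eq_of_reachable`, "a cluster has
  one top"), the open edges at distinct clusters are disjoint
  (`LoopCrossCount.disjoint_sep_of_not_reachable`) and cross the annulus of their loop
  (`LoopCrossCount.sep_mem_annulusOpenCrossing`), all from `…LoopCrossCountZ2Clusters`;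
* §3 **the clockwise loops** (`BigLoopsExp.mem_foldr_dualConfig_of_typeZero_families`): the same
  for families of type-`0` loops, read on `dualConfig ω` about the centres shifted by `-δ(1+i)/2`
  (clockwise loops of `ω` are, translated and reversed, counter-clockwise loops of the dual,
  `mem_bondLoopConfig_dualConfig_iff` of `…BondDuality`).
-/

noncomputable section

open MeasureTheory Set Filter Metric
open scoped Real Topology BigOperators ENNReal

namespace Summit.CriticalPhenomena.CardyFormulaZ2.Cruxes.NestingRigidity.PositiveConeWeightDoubling

open Literature.Probability.RandomPlanarGeometry Literature.Probability.Percolation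
  Literature.Probability.LatticeModels
open Summit.CriticalPhenomena.CardyFormulaZ2.Cruxes.NestingRigidity.RingCloudTomography
open Summit.CriticalPhenomena.CardyFormulaZ2.Cruxes.NestingRigidity.MarkovCascadeOneGeneration
  (mem_bondLoopConfig_dualConfig_iff map_translate_map_translate_neg continuous_translate
    isometry_translate)

namespace BigLoopsExp

/-! ## §1 Joint disjoint occurrence of a finite family of powers of increasing events -/

section Joint

variable {ι : Type*}

/-- A `□`-fold of increasing events is increasing. -/
theorem isUpperSet_foldr {L : List (Set (Set ι))} (hL : ∀ A ∈ L, IsUpperSet A) :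
    IsUpperSet (L.foldr disjointOccurrence univ) := by
  induction L with
  | nil => exact isUpperSet_univ
  | cons A L ih =>
    rw [List.foldr_cons]
    exact (hL A (by simp)).disjointOccurrence (ih fun B hB ↦ hL B (by simp [hB]))

/-- A `□`-fold of events determined by `F` is determined by `F`. -/
theorem determinedBy_foldr {L : List (Set (Set ι))} {F : Set ι} (hL : ∀ A ∈ L, DeterminedBy A F) :
    DeterminedBy (L.foldr disjointOccurrence univ) F := by
  induction L with
  | nil => exact determinedBy_univ F
  | cons A L ih =>
    rw [List.foldr_cons]
    exact (hL A (by simp)).disjointOccurrence (ih fun B hB ↦ hL B (by simp [hB]))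

/-- The members of `List.ofFn fun i ↦ (A i)^{□ k i}` are increasing if the `A i` are. -/
theorem isUpperSet_of_mem_ofFn {B : ℕ} {A : Fin B → Set (Set ι)} (hA : ∀ i, IsUpperSet (A i))
    (k : Fin B → ℕ) :
    ∀ E ∈ List.ofFn (fun i ↦ disjointOccurrencePow (A i) (k i)), IsUpperSet E := by
  intro E hE
  obtain ⟨i, rfl⟩ := (List.mem_ofFn' _ _).1 hE
  exact (hA i).disjointOccurrencePow (k i)

/-- The members of `List.ofFn fun i ↦ (A i)^{□ k i}` are determined by `F` if the `A i` are. -/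
theorem determinedBy_of_mem_ofFn {B : ℕ} {A : Fin B → Set (Set ι)} {F : Set ι}
    (hA : ∀ i, DeterminedBy (A i) F) (k : Fin B → ℕ) :
    ∀ E ∈ List.ofFn (fun i ↦ disjointOccurrencePow (A i) (k i)), DeterminedBy E F := by
  intro E hE
  obtain ⟨i, rfl⟩ := (List.mem_ofFn' _ _).1 hE
  exact (hA i).disjointOccurrencePow (k i)

/-- **Disjoint witnesses give joint disjoint occurrence.**  For increasing events `A i`
(`i : Fin B`) and multiplicities `k i`: if `ω` contains pairwise disjoint sub-configurations
`W ⟨i, j⟩` (`j : Fin (k i)`) with `W ⟨i, j⟩ ∈ A i`, then `ω` lies in the joint disjoint occurrence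
`(A 0)^{□ k 0} □ ((A 1)^{□ k 1} □ ⋯)`. -/
theorem mem_foldr_ofFn_of_pairwise_disjoint :
    ∀ {B : ℕ} {A : Fin B → Set (Set ι)} (_ : ∀ i, IsUpperSet (A i)) {k : Fin B → ℕ} {ω : Set ι}
      (W : (Σ i : Fin B, Fin (k i)) → Set ι), (∀ a, W a ⊆ ω) → (∀ a, W a ∈ A a.1) →
      Pairwise (fun a b ↦ Disjoint (W a) (W b)) →
      ω ∈ (List.ofFn fun i ↦ disjointOccurrencePow (A i) (k i)).foldr disjointOccurrence univ
  | 0, _, _, _, _, _, _, _, _ => by simp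
  | B + 1, A, hA, k, ω, W, hWω, hWA, hdisj => by
    rw [List.ofFn_succ, List.foldr_cons,
      ((hA 0).disjointOccurrencePow (k 0)).mem_disjointOccurrence_iff
        (isUpperSet_foldr (isUpperSet_of_mem_ofFn (fun i ↦ hA i.succ) _))]
    -- the first block of witnesses and the rest
    set K₀ : Set ι := ⋃ j : Fin (k 0), W ⟨0, j⟩ with hK₀
    set ω' : Set ι := ⋃ a : (Σ i : Fin B, Fin (k i.succ)), W ⟨a.1.succ, a.2⟩ with hω'
    have hne0 : ∀ (j : Fin (k 0)) (a : Σ i : Fin B, Fin (k i.succ)),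
        (⟨0, j⟩ : Σ i : Fin (B + 1), Fin (k i)) ≠ ⟨a.1.succ, a.2⟩ := fun j a h ↦
      (Fin.succ_ne_zero a.1).symm (congrArg Sigma.fst h)
    refine ⟨K₀, iUnion_subset fun j ↦ hWω _, ω', iUnion_subset fun a ↦ hWω _, ?_, ?_, ?_⟩
    · rw [hK₀, hω', disjoint_iUnion_left]
      intro j
      rw [disjoint_iUnion_right]
      exact fun a ↦ hdisj (hne0 j a)
    · refine mem_disjointOccurrencePow_of_pairwise_disjoint (hA 0) (fun j ↦ W ⟨0, j⟩)
        (fun j ↦ subset_iUnion (fun j : Fin (k 0) ↦ W ⟨0, j⟩) j) (fun j ↦ hWA ⟨0, j⟩)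
        fun j j' hjj' ↦ hdisj fun h ↦ hjj' ?_
      cases h
      rfl
    · refine mem_foldr_ofFn_of_pairwise_disjoint (fun i ↦ hA i.succ)
        (fun a : (Σ i : Fin B, Fin (k i.succ)) ↦ W ⟨a.1.succ, a.2⟩)
        (fun a ↦ subset_iUnion (fun a : (Σ i : Fin B, Fin (k i.succ)) ↦ W ⟨a.1.succ, a.2⟩) a)
        (fun a ↦ hWA ⟨a.1.succ, a.2⟩) fun a b hab ↦ hdisj fun h ↦ hab ?_
      obtain ⟨i, j⟩ := a
      obtain ⟨i', j'⟩ := b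
      simp only [Sigma.mk.inj_iff, Fin.succ_inj] at h
      obtain ⟨rfl, hjj'⟩ := h
      simp only [heq_eq_eq] at hjj'
      subst hjj'
      rfl

/-- **Iterated BK for the joint disjoint occurrence.**  If `μ` satisfies the BK inequality for
increasing events determined by `F` (bond-`ℤ²`: `reimer_holds`; site-`𝕋`: `sitePercolation_bk`),
then for increasing `A i` determined by `F`,
`μ((A 0)^{□ k 0} □ ((A 1)^{□ k 1} □ ⋯)) ≤ ∏ i μ(A i)^{k i}`. -/
theorem measureReal_foldr_ofFn_le_prod (μ : Measure (Set ι)) [IsProbabilityMeasure μ] {F : Set ι}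
    (hBK : ∀ A B : Set (Set ι), IsUpperSet A → IsUpperSet B → DeterminedBy A F →
      DeterminedBy B F → μ.real (A □ B) ≤ μ.real A * μ.real B) :
    ∀ {B : ℕ} (A : Fin B → Set (Set ι)) (k : Fin B → ℕ), (∀ i, IsUpperSet (A i)) →
      (∀ i, DeterminedBy (A i) F) →
      μ.real ((List.ofFn fun i ↦ disjointOccurrencePow (A i) (k i)).foldr disjointOccurrence univ) ≤
        ∏ i, (μ.real (A i)) ^ (k i)
  | 0, A, k, _, _ => by simp
  | B + 1, A, k, hA, hAF => by
    -- the power of one event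
    have hpow : ∀ (E : Set (Set ι)), IsUpperSet E → DeterminedBy E F →
        ∀ n : ℕ, μ.real (disjointOccurrencePow E n) ≤ (μ.real E) ^ n := by
      intro E hE hEF n
      induction n with
      | zero => simp
      | succ n ih =>
        rw [disjointOccurrencePow_succ, pow_succ']
        exact (hBK E _ hE (hE.disjointOccurrencePow n) hEF (hEF.disjointOccurrencePow n)).trans
          (mul_le_mul_of_nonneg_left ih measureReal_nonneg)
    rw [List.ofFn_succ, List.foldr_cons, Fin.prod_univ_succ]
    have hrestU : IsUpperSet ((List.ofFn fun i : Fin B ↦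
        disjointOccurrencePow (A i.succ) (k i.succ)).foldr disjointOccurrence univ) :=
      isUpperSet_foldr (isUpperSet_of_mem_ofFn (fun i ↦ hA i.succ) _)
    have hrestF : DeterminedBy ((List.ofFn fun i : Fin B ↦
        disjointOccurrencePow (A i.succ) (k i.succ)).foldr disjointOccurrence univ) F :=
      determinedBy_foldr (determinedBy_of_mem_ofFn (fun i ↦ hAF i.succ) _)
    calc μ.real (disjointOccurrencePow (A 0) (k 0) □ (List.ofFn fun i : Fin B ↦
          disjointOccurrencePow (A i.succ) (k i.succ)).foldr disjointOccurrence univ)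
        ≤ μ.real (disjointOccurrencePow (A 0) (k 0)) * μ.real ((List.ofFn fun i : Fin B ↦
            disjointOccurrencePow (A i.succ) (k i.succ)).foldr disjointOccurrence univ) :=
          hBK _ _ ((hA 0).disjointOccurrencePow _) hrestU ((hAF 0).disjointOccurrencePow _) hrestF
      _ ≤ (μ.real (A 0)) ^ (k 0) * ∏ i : Fin B, (μ.real (A i.succ)) ^ (k i.succ) :=
          mul_le_mul (hpow _ (hA 0) (hAF 0) _)
            (measureReal_foldr_ofFn_le_prod μ hBK (fun i ↦ A i.succ) (fun i ↦ k i.succ)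
              (fun i ↦ hA i.succ) (fun i ↦ hAF i.succ))
            measureReal_nonneg (pow_nonneg measureReal_nonneg _)

end Joint

/-! ## §2 Bond-`ℤ²`: disjoint families of counter-clockwise crossing loops -/

/-- **Deterministic core of K6 on bond-`ℤ²`, type `1`.**  Let `ω ⊆ E(ℤ²)` be a lattice
configuration at mesh `δ > 0`, `a + 2δ ≤ b`, and let `T i` (`i : Fin B`) be pairwise disjoint
finite families of counter-clockwise (type-`1`) loops of `bondLoopConfig δ 0 ω`, every loop of
`T i` meeting `B̄(c i, a)` and `ℂ ∖ B(c i, b)`.  Then for all `k i ≤ #T i`, `ω` lies in the joint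
disjoint occurrence of the events `(annulusOpenCrossing (c i) δ (a i + δ) (b i - δ))^{□ k i}`: the rim
clusters of distinct type-`1` loops are distinct (`LoopCrossCount.unbasedLoop_eq_of_reachable`), the
open edges at them are pairwise disjoint witnesses (`LoopCrossCount.disjoint_sep_of_not_reachable`)
crossing the annulus of their loop (`LoopCrossCount.sep_mem_annulusOpenCrossing`). -/
theorem mem_foldr_of_typeOne_families {ω : BondConfig (Site 2)} (hω : ω ⊆ (zdGraph 2).edgeSet)
    {δ : ℝ} (hδ : 0 < δ) {B : ℕ} {a b : Fin B → ℝ} (hab : ∀ i, a i + 2 * δ ≤ b i) (c : Fin B → ℂ)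
    (T : Fin B → Set (UnbasedLoop ℂ)) (hT : ∀ i, T i ⊆ (bondLoopConfig δ 0 ω).F 1)
    (hTfin : ∀ i, (T i).Finite) (hTdisj : Pairwise fun i i' ↦ Disjoint (T i) (T i'))
    (hmeet : ∀ i, ∀ u ∈ T i, (u.range ∩ Metric.closedBall (c i) (a i)).Nonempty ∧
      (u.range ∩ (Metric.ball (c i) (b i))ᶜ).Nonempty)
    (k : Fin B → ℕ) (hk : ∀ i, k i ≤ (T i).ncard) :
    ω ∈ (List.ofFn fun i ↦ disjointOccurrencePow
      (annulusOpenCrossing (c i) δ (a i + δ) (b i - δ)) (k i)).foldr disjointOccurrence univ := by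
  classical
  -- `k i` distinct loops of `T i`
  have hsel : ∀ i, ∃ u : Fin (k i) → UnbasedLoop ℂ, Function.Injective u ∧ ∀ j, u j ∈ T i := by
    intro i
    have hcard : k i ≤ (hTfin i).toFinset.card := by
      rw [← Set.ncard_eq_toFinset_card (T i) (hTfin i)]; exact hk i
    refine ⟨fun j ↦ ((hTfin i).toFinset.equivFin.symm (Fin.castLE hcard j) : UnbasedLoop ℂ),
      fun j j' h ↦ ?_, fun j ↦ ?_⟩
    · exact Fin.castLE_injective hcard
        ((hTfin i).toFinset.equivFin.symm.injective (Subtype.ext h))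
    · exact (hTfin i).mem_toFinset.1 ((hTfin i).toFinset.equivFin.symm (Fin.castLE hcard j)).2
  choose u huinj huT using hsel
  -- distinct indices carry distinct loops
  have hne : ∀ a a' : (Σ i : Fin B, Fin (k i)), a ≠ a' → u a.1 a.2 ≠ u a'.1 a'.2 := by
    rintro ⟨i, j⟩ ⟨i', j'⟩ haa' heq
    dsimp only at heq
    by_cases hii' : i = i'
    · subst hii'
      exact haa' (by rw [huinj i heq])
    · exact Set.disjoint_left.1 (hTdisj hii') (huT i j) (by rw [heq]; exact huT i' j')
  -- representatives and a dart of each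
  have hrep : ∀ a : (Σ i : Fin B, Fin (k i)), ∃ (γ : List MedialVertex) (h : IsInterfaceLoop ω γ),
      loopType γ = 1 ∧
      u a.1 a.2 = UnbasedLoop.mk (BasedLoop.mk (loopCurve δ 0 γ) (isLoop_loopCurve δ 0 h.ne_nil)) :=
    fun a ↦ mem_bondLoopConfig_iff.1 (hT a.1 (huT a.1 a.2))
  choose γ hγ htγ hγu using hrep
  have hdart : ∀ a : (Σ i : Fin B, Fin (k i)), ∃ p : Site 2 × Fin 4,
      (cSrc p, cTgt p) ∈ (γ a).zip ((γ a).rotate 1) := fun a ↦ by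
    obtain ⟨p, hps, hpt⟩ := (hγ a).exists_corner 0
    exact ⟨p, by rw [hps, hpt]; exact (hγ a).getElem_mod_mem_zip 0⟩
  choose p hp using hdart
  refine mem_foldr_ofFn_of_pairwise_disjoint (fun i ↦ isUpperSet_annulusOpenCrossing (c i) δ _ _)
    (fun a ↦ {e ∈ ω | ∃ y, (openGraph ω).Reachable (p a).1 y ∧ y ∈ e})
    (fun a ↦ Set.sep_subset _ _) (fun a ↦ ?_) (fun a a' haa' ↦ ?_)
  · obtain ⟨⟨z, hzu, hza⟩, ⟨z', hz'u, hz'b⟩⟩ := hmeet a.1 _ (huT a.1 a.2)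
    rw [hγu a] at hzu hz'u
    exact LoopCrossCount.sep_mem_annulusOpenCrossing (hγ a) hδ (c a.1) (hab a.1) (hp a) hzu hz'u
      (mem_closedBall.1 hza) (not_lt.1 fun hlt ↦ hz'b (mem_ball.2 hlt))
  · refine LoopCrossCount.disjoint_sep_of_not_reachable hω fun hreach ↦ hne a a' haa' ?_
    rw [hγu a, hγu a']
    exact LoopCrossCount.unbasedLoop_eq_of_reachable (hγ a) (hγ a') hω (htγ a) (htγ a') (hp a)
      (hp a') hreach δ

/-! ## §3 Bond-`ℤ²`: clockwise loops, through the dual configuration -/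

/-- **Deterministic core of K6 on bond-`ℤ²`, type `0`.**  The same for pairwise disjoint finite
families `T i` of clockwise (type-`0`) loops of `bondLoopConfig δ 0 ω`: then `dualConfig ω` lies in
the joint disjoint occurrence of the open annulus crossings about the centres `c i - δ(1+i)/2`.
Clockwise loops of `ω` are, translated by `-δ(1+i)/2` and reversed, counter-clockwise loops of
`dualConfig ω` (`mem_bondLoopConfig_dualConfig_iff`, `…BondDuality`), injectively; then §2 for the
lattice configuration `dualConfig ω`. -/
theorem mem_foldr_dualConfig_of_typeZero_families {ω : BondConfig (Site 2)}
    (hω : ω ⊆ (zdGraph 2).edgeSet) {δ : ℝ} (hδ : 0 < δ) {B : ℕ} {a b : Fin B → ℝ}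
    (hab : ∀ i, a i + 2 * δ ≤ b i) (c : Fin B → ℂ) (T : Fin B → Set (UnbasedLoop ℂ))
    (hT : ∀ i, T i ⊆ (bondLoopConfig δ 0 ω).F 0)
    (hTfin : ∀ i, (T i).Finite) (hTdisj : Pairwise fun i i' ↦ Disjoint (T i) (T i'))
    (hmeet : ∀ i, ∀ u ∈ T i, (u.range ∩ Metric.closedBall (c i) (a i)).Nonempty ∧
      (u.range ∩ (Metric.ball (c i) (b i))ᶜ).Nonempty)
    (k : Fin B → ℕ) (hk : ∀ i, k i ≤ (T i).ncard) :
    dualConfig ω ∈ (List.ofFn fun i ↦ disjointOccurrencePow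
      (annulusOpenCrossing (c i - δ * (1 + Complex.I) / 2) δ (a i + δ) (b i - δ)) (k i)).foldr
        disjointOccurrence univ := by
  -- adapted from `LoopCrossCount.ncard_typeZero_le_ncard_typeOne_dualConfig`
  set g : UnbasedLoop ℂ → UnbasedLoop ℂ := fun u ↦
    (u.map ⟨fun w ↦ 1 * w + -(δ * (1 + Complex.I) / 2), continuous_translate _⟩
      (isometry_translate _)).reverse with hg
  have hback : ∀ u : UnbasedLoop ℂ, ((g u).map ⟨fun w ↦ 1 * w + δ * (1 + Complex.I) / 2,
      continuous_translate (δ * (1 + Complex.I) / 2)⟩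
      (isometry_translate (δ * (1 + Complex.I) / 2))).reverse = u := by
    intro u
    have key := map_translate_map_translate_neg u (-(δ * (1 + Complex.I) / 2))
    simp only [neg_neg] at key
    rw [hg]
    dsimp only
    rw [← UnbasedLoop.reverse_map, UnbasedLoop.reverse_reverse, key]
  have hginj : Function.Injective g := fun u₁ u₂ h12 ↦ by rw [← hback u₁, ← hback u₂, h12]
  have hrange : ∀ (u : UnbasedLoop ℂ) (z : ℂ), z ∈ u.range →
      z - δ * (1 + Complex.I) / 2 ∈ (g u).range := by
    intro u z hz
    rw [hg]
    dsimp only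
    rw [UnbasedLoop.range_reverse, UnbasedLoop.range_map]
    exact ⟨z, hz, by simp [sub_eq_add_neg]⟩
  have hωd : dualConfig ω ⊆ (zdGraph 2).edgeSet := Set.sdiff_subset
  refine mem_foldr_of_typeOne_families hωd hδ hab _ (fun i ↦ g '' T i) (fun i ↦ ?_)
    (fun i ↦ (hTfin i).image g) (fun i i' hii' ↦ (Set.disjoint_image_iff hginj).2 (hTdisj hii'))
    (fun i ↦ ?_) k (fun i ↦ ?_)
  · rintro _ ⟨u, hu, rfl⟩
    rw [mem_bondLoopConfig_dualConfig_iff δ ω hω 1 (g u), hback u]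
    exact hT i hu
  · rintro _ ⟨u, hu, rfl⟩
    obtain ⟨⟨z, hzu, hza⟩, ⟨z', hz'u, hz'b⟩⟩ := hmeet i u hu
    refine ⟨⟨z - δ * (1 + Complex.I) / 2, hrange u z hzu, ?_⟩,
      ⟨z' - δ * (1 + Complex.I) / 2, hrange u z' hz'u, ?_⟩⟩
    · rw [mem_closedBall] at hza ⊢
      rwa [dist_sub_right]
    · rw [Set.mem_compl_iff, mem_ball] at hz'b ⊢
      rwa [dist_sub_right]
  · rw [Set.ncard_image_of_injective _ hginj]
    exact hk i

end BigLoopsExp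

/-! ## §4 Anchor: the type-`1` core on `zEns` in registered form -/

/-- **Anchor (helper toward K6 `expMoment_ncard_bigLoops_le`).**  On `zEns` (bond-`ℤ²`), for a
lattice configuration `ω ⊆ E(ℤ²)` at mesh `δ > 0`: pairwise disjoint finite families `T i` of
counter-clockwise loops of `zEns.X δ ω`, the loops of `T i` meeting `B̄(c i, a i)` and
`ℂ ∖ B(c i, b i)` (`a i + 2δ ≤ b i`), put `ω` in the joint disjoint occurrence
`(A 0)^{□ k 0} □ ((A 1)^{□ k 1} □ ⋯)` of the open annulus crossings
`A i = annulusOpenCrossing (c i) δ (a i + δ) (b i - δ)`, for all `k i ≤ #T i`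
(`BigLoopsExp.mem_foldr_of_typeOne_families`). -/
theorem mem_foldr_annulusOpenCrossing_of_typeOne_zEns : ∀ (ω : BondConfig (Site 2)) (δ : ℝ) (B : ℕ) (a b : Fin B → ℝ) (c : Fin B → ℂ) (T : Fin B → Set (UnbasedLoop ℂ)) (k : Fin B → ℕ), ω ⊆ (zdGraph 2).edgeSet → 0 < δ → (∀ i, a i + 2 * δ ≤ b i) → (∀ i, T i ⊆ (zEns.X δ ω).F 1) → (∀ i, (T i).Finite) → (Pairwise fun i i' ↦ Disjoint (T i) (T i')) → (∀ i, ∀ u ∈ T i, (u.range ∩ Metric.closedBall (c i) (a i)).Nonempty ∧ (u.range ∩ (Metric.ball (c i) (b i))ᶜ).Nonempty) → (∀ i, k i ≤ (T i).ncard) → ω ∈ (List.ofFn fun i ↦ disjointOccurrencePow (annulusOpenCrossing (c i) δ (a i + δ) (b i - δ)) (k i)).foldr disjointOccurrence Set.univ := by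
  intro ω δ B a b c T k hω hδ hab hT hTfin hTdisj hmeet hk
  exact BigLoopsExp.mem_foldr_of_typeOne_families hω hδ hab c T hT hTfin hTdisj hmeet k hk

end Summit.CriticalPhenomena.CardyFormulaZ2.Cruxes.NestingRigidity.PositiveConeWeightDoubling

end
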